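import Summits.CriticalPhenomena.PercolationContinuityZ3.Theorems.PercNearOneGluingNoHeavyPcintBSMXDisp
import Summits.CriticalPhenomena.PercolationContinuityZ3.Theorems.PercNearOneGluingNoHeavyPcintBSMXTwo
import HarnessLib

/-!
# PCINT lane, PHASE 6 (block renewal with reach-two pieces): the two-axes tail from central binomial data

Cell `prim-pcint`, seat `prim-pcint-1` (gen 15); memo `run/shared/lean/prim/pcint/T-FIBRE-ROUTE.md` §PHASE 6.

The sharper two-axes tail `BSMX.tailBound_two'` (…PcintBSMXDisp) needs `u 2 N`; for the long horizons of the
`ℤ⁴` instance the tree's rational table `OSM.vrow 2 N` is too heavy for the kernel, so here the tail is discharged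
from the iterative central binomial list `BSMX.cbList` (`u 2 N = C(2N,N)/4^N`): **`BSMX.tailBoundH_of_twoCbQ`**.
-/

noncomputable section

namespace Summit.CriticalPhenomena.PercolationContinuityZ3.Theorems.Pcint.BSMX

open Finset OSM BSM

variable {t : ℕ}

/-- **The sharper two-axes tail from a kernel check on central binomial data**: with `c = (cbList N)[N] = C(2N,N)`,
`c/4^N · [(2N+2)/((2N+1) 8a₁) + r^{2N}/(1-r²)/2] ≤ Tn/DG` (`r = 1 - 4a₁`, over `ℚ`) gives the tail bound `Tn/DG`. -/
theorem tailBoundH_of_twoCbQ (ht : 2 ≤ t) {A0 A1 A2 DA : ℕ} (hDA : A0 + 2 * A1 + 2 * A2 = DA) (hA1 : 0 < A1)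
    (hA4 : 4 * A1 + 2 * A2 ≤ DA) (hA4' : 4 * A1 < DA) (N : ℕ) {Tn DG : ℕ}
    (h : (((cbList N).getD N 0 : ℕ) : ℚ) / 4 ^ N * (2 * (N : ℚ) + 2) / ((2 * (N : ℚ) + 1) * (8 * ((A1 : ℚ) / DA))) +
      (((cbList N).getD N 0 : ℕ) : ℚ) / 4 ^ N * (1 - 4 * ((A1 : ℚ) / DA)) ^ (2 * N) /
        (1 - (1 - 4 * ((A1 : ℚ) / DA)) ^ 2) / 2 ≤ (Tn : ℚ) / DG) :
    TailBoundH t 2 ((A1 : ℝ) / DA) ((A2 : ℝ) / DA) N ((Tn : ℝ) / DG) := by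
  have hadm := adm_of_nat hDA hA1 hA4
  have hDAR : (0 : ℝ) < DA := by exact_mod_cast (by omega : 0 < DA)
  have ha : 4 * ((A1 : ℝ) / DA) < 1 := by
    rw [show 4 * ((A1 : ℝ) / DA) = (4 * A1 : ℝ) / DA by ring, div_lt_one hDAR]; exact_mod_cast hA4'
  refine tailBound_two' hadm ht ha N ?_
  have h' := (Rat.cast_le (K := ℝ)).2 h
  push_cast at h'
  rw [(cbList_getD N N le_rfl).1] at h'
  rw [u_two_eq]
  exact h'

end Summit.CriticalPhenomena.PercolationContinuityZ3.Theorems.Pcint.BSMX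

end
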